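import Mathlib
import Summits.NavierStokesRegularity.NavierStokesRegularity.Theorems.LevelSetModerationHighSpeedPressureWorkFourThreshold

/-!
# Route LevelSetModeration — anatomy of the crux: `HighSpeedPressureWork ↔ UniformBound ∧ EarlyBookkeeping`

Support file for item stmt-NavierStokesRegularity-18149 (`HighSpeedPressureWork`). The final
structure theorem of the crux chain (line `iso-speed-area-closure`, skeleton v4):

  `HighSpeedPressureWork ↔ (UniformBound ∧ EarlyBookkeeping)`
  (`levelSetModeration_highSpeedPressureWork_iff_uniformBound_and_early`),

where `UniformBound` is the class-uniform a priori speed bound (quantitative regularity of the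
data class `(ν, T, E₀, B₀)`) and `EarlyBookkeeping` is VERBATIM the registered stub
`stub_earlyBookkeeping` (the pairing bound without `M`-factor in the early window
`t ≤ cₑν/B₀²`, unconditional).

* `→`: the crux gives the uniform bound (`levelSetModeration_uniformBound_of_highSpeedPressureWork'`)
  and, with it, absorbs its own `M`-factor: for `c ≥ G(E₀,B₀)` nothing is fast and the pressure work
  vanishes, otherwise `M ≤ 2c < 2G` bounds `M^m` (and `M ≥ 2B₀ > 0` for `m < 0`), so the crux's
  bound holds with `F' = F⁺ ((2G ∨ 2B₀)^m + (2B₀)^m)` at all times, in particular early.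
* `←`: split the pressure work at `s = cₑν/B₀²`: the early part is `EarlyBookkeeping`, the late
  part is the landed `levelSetModeration_latePairingBookkeeping` (pointwise pressure bound after the
  smoothing delay); `√(F₁V)√D + √(F₂V)√D = √((√F₁+√F₂)² V) √D`; exponent `m = 0`.

Together with `levelSetModeration_earlyBookkeepingWithMargin` (the early bookkeeping holds at
every positive margin) and `levelSetModeration_highSpeedPressureWorkMargin_iff_uniformBound`, this
locates the entire content of the crux beyond quantitative regularity at margin zero: the pairing
law on `{|u| > c}` for `c ↓ sup|u₀|` during `t ≲ ν/B₀²`.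
-/

noncomputable section

-- single-conjunct summit: `Summit.<Summit>.<Problem>` repeats the name by the D-0017 layout
set_option linter.dupNamespace false

namespace Summit.NavierStokesRegularity.NavierStokesRegularity.Theorems

open MeasureTheory Set Filter Topology Function
open scoped ENNReal
open Literature.Analysis.FluidPDE
open Summit.NavierStokesRegularity.NavierStokesRegularity.Theses.LevelSetModeration

/-- The pressure-work integrand vanishes where the speed does not exceed the level: if
`‖v x‖ ≤ c` then `max (1 - c/‖v x‖) 0 * Dq(x)(v x) = 0` (for `v x = 0` Lean's `c/0 = 0` makes the
weight `1`, but `Dq(x)(0) = 0`). [folklore] -/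
theorem levelSetModeration_pairingIntegrand_eq_zero_of_le {v : EuclideanSpace ℝ (Fin 3) → EuclideanSpace ℝ (Fin 3)}
    {q : EuclideanSpace ℝ (Fin 3) → ℝ} {c : ℝ} {x : EuclideanSpace ℝ (Fin 3)}
    (hx : ‖v x‖ ≤ c) : max (1 - c / ‖v x‖) 0 * (fderiv ℝ q x (v x)) = 0 := by
  by_cases h0 : v x = 0
  · rw [h0, map_zero, mul_zero]
  · have hpos : 0 < ‖v x‖ := norm_pos_iff.2 h0
    have h1 : 1 - c / ‖v x‖ ≤ 0 := by
      rw [sub_nonpos, le_div_iff₀ hpos, one_mul]; exact hx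
    rw [max_eq_right h1, zero_mul]

/-- **Anatomy of the crux.** `HighSpeedPressureWork` is equivalent to the conjunction of the
class-uniform a priori speed bound and the (registered, unconditional) early bookkeeping
`stub_earlyBookkeeping`. [folklore] -/
theorem levelSetModeration_highSpeedPressureWork_iff_uniformBound_and_early :
    Summit.NavierStokesRegularity.NavierStokesRegularity.Theses.LevelSetModeration.HighSpeedPressureWork ↔ ((∀ (ν T : ℝ), 0 < ν → 0 < T → ∀ (E₀ B₀ : ℝ), ∃ G : ℝ, ∀ (u : ℝ → EuclideanSpace ℝ (Fin 3) → EuclideanSpace ℝ (Fin 3)) (p : ℝ → EuclideanSpace ℝ (Fin 3) → ℝ), Literature.Analysis.FluidPDE.IsClassicalNSSolutionOn (Set.Ico 0 T) ν 0 u p → Literature.Analysis.FluidPDE.IsLerayHopfOn T ν 0 (u 0) u → Literature.Analysis.FluidPDE.HasRapidSpatialDecay (u 0) → (∫ x, ‖u 0 x‖ ^ 2) ≤ E₀ → (∀ x, ‖u 0 x‖ ≤ B₀) → ∀ t ∈ Set.Ico 0 T, ∀ x, ‖u t x‖ ≤ G) ∧ (∃ cₑ : ℝ, 0 < cₑ ∧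 ∀ (ν T : ℝ), 0 < ν → 0 < T → ∃ F : ℝ → ℝ → ℝ, ∀ (u : ℝ → EuclideanSpace ℝ (Fin 3) → EuclideanSpace ℝ (Fin 3)) (p : ℝ → EuclideanSpace ℝ (Fin 3) → ℝ), Literature.Analysis.FluidPDE.IsClassicalNSSolutionOn (Set.Ico 0 T) ν 0 u p → Literature.Analysis.FluidPDE.IsLerayHopfOn T ν 0 (u 0) u → Literature.Analysis.FluidPDE.HasRapidSpatialDecay (u 0) → ∀ (E₀ B₀ : ℝ), (∫ x, ‖u 0 x‖ ^ 2) ≤ E₀ → (∀ x, ‖u 0 x‖ ≤ B₀) → ∀ (M c t : ℝ), 2 * B₀ ≤ M → M / 2 ≤ c → c ≤ M → 0 < c → t ∈ Set.Ico 0 T → t ≤ cₑ * ν / B₀ ^ 2 → -(∫ τ in Set.Ioo 0 t, ∫ x, max (1 - c / ‖u τ x‖) 0 * (fderiv ℝ (Literature.Analysis.FluidPDE.normalisedPressure (u τ)) x (u τ x))) ≤ Real.sqrt (F E₀ B₀ * (∫⁻ τ in Set.Ioo 0 T, volume {x | c < ‖u τ x‖}).toReal) * Real.sqrt ((∫⁻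 τ in Set.Ioo 0 T, ∫⁻ x, Set.indicator {x | c < ‖u τ x‖} (fun x => ENNReal.ofReal (‖fderiv ℝ (fun y => ‖u τ y‖) x‖ ^ 2)) x).toReal))) := by
  constructor
  · intro hX
    have hU := levelSetModeration_uniformBound_of_highSpeedPressureWork' hX
    refine ⟨hU, 1, one_pos, ?_⟩
    intro ν T hν hT
    obtain ⟨m, hm, F, hF⟩ := hX ν T hν hT
    choose G hG using fun E₀ B₀ => hU ν T hν hT E₀ B₀
    refine ⟨fun E₀ B₀ => max (F E₀ B₀) 0 *
      (|max (2 * G E₀ B₀) (2 * B₀)| ^ m + |2 * B₀| ^ m), ?_⟩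
    intro u p hcl hLH hdec E₀ B₀ hE₀ hbd0 M c t hM hMc hcM hc ht _hte
    beta_reduce
    set V : ℝ := (∫⁻ τ in Ioo 0 T, volume {x | c < ‖u τ x‖}).toReal with hV
    set D : ℝ := (∫⁻ τ in Ioo 0 T, ∫⁻ x, {x | c < ‖u τ x‖}.indicator
      (fun x => ENNReal.ofReal (‖fderiv ℝ (fun y => ‖u τ y‖) x‖ ^ 2)) x).toReal with hD
    have hV0 : 0 ≤ V := ENNReal.toReal_nonneg
    by_cases hslow : ∀ τ ∈ Ioo 0 t, ∀ x, ‖u τ x‖ ≤ c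
    · -- nothing is fast: the pressure work vanishes
      have hzero : (∫ τ in Ioo 0 t, ∫ x, max (1 - c / ‖u τ x‖) 0 *
          (fderiv ℝ (normalisedPressure (u τ)) x (u τ x))) = 0 := by
        refine setIntegral_eq_zero_of_forall_eq_zero fun τ hτ => ?_
        refine integral_eq_zero_of_ae (Eventually.of_forall fun x => ?_)
        exact levelSetModeration_pairingIntegrand_eq_zero_of_le (hslow τ hτ x)
      rw [hzero, neg_zero]
      exact mul_nonneg (Real.sqrt_nonneg _) (Real.sqrt_nonneg _)
    · push Not at hslow
      obtain ⟨τ₀, hτ₀, x₀, hx₀⟩ := hslow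
      have hτ₀' : τ₀ ∈ Ico 0 T := ⟨hτ₀.1.le, hτ₀.2.trans ht.2⟩
      -- a fast point exists: `c < G(E₀,B₀)` and `B₀ > 0`
      have hcG : c < G E₀ B₀ := hx₀.trans_le (hG E₀ B₀ u p hcl hLH hdec hE₀ hbd0 τ₀ hτ₀' x₀)
      have hB₀pos : 0 < B₀ := by
        by_contra hB
        rw [not_lt] at hB
        have h0 : ∀ y, u 0 y = 0 := fun y => norm_le_zero_iff.1 ((hbd0 y).trans hB)
        have := levelSetModeration_slice_eq_zero_of_datum hcl hLH hν.le h0 hτ₀' x₀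
        rw [this, norm_zero] at hx₀
        exact absurd hx₀ (not_lt.2 hc.le)
      have hMpos : 0 < M := by linarith
      -- `M^m ≤ |2G ∨ 2B₀|^m + |2B₀|^m`
      have hMm : M ^ m ≤ |max (2 * G E₀ B₀) (2 * B₀)| ^ m + |2 * B₀| ^ m := by
        have hA : M ≤ |max (2 * G E₀ B₀) (2 * B₀)| := by
          refine le_trans ?_ (le_abs_self _)
          exact le_trans (by linarith) (le_max_left _ _)
        have h1 : 0 ≤ |max (2 * G E₀ B₀) (2 * B₀)| ^ m := Real.rpow_nonneg (abs_nonneg _) m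
        have h2 : 0 ≤ |2 * B₀| ^ m := Real.rpow_nonneg (abs_nonneg _) m
        rcases le_or_gt 0 m with hm0 | hm0
        · have := Real.rpow_le_rpow hMpos.le hA hm0
          linarith
        · have hB : |2 * B₀| ≤ M := by rw [abs_of_pos (by positivity)]; exact hM
          have := Real.rpow_le_rpow_of_nonpos (by positivity : 0 < |2 * B₀|) hB hm0.le
          linarith
      have key := hF u p hcl hLH hdec E₀ B₀ hE₀ hbd0 M c t hM hMc hcM hc ht
      refine key.trans ?_
      have hFle : F E₀ B₀ * M ^ m * V ≤
          max (F E₀ B₀) 0 * (|max (2 * G E₀ B₀) (2 * B₀)| ^ m + |2 * B₀| ^ m) * V := by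
        refine mul_le_mul_of_nonneg_right ?_ hV0
        calc F E₀ B₀ * M ^ m ≤ max (F E₀ B₀) 0 * M ^ m :=
              mul_le_mul_of_nonneg_right (le_max_left _ _) (Real.rpow_nonneg hMpos.le m)
          _ ≤ max (F E₀ B₀) 0 * (|max (2 * G E₀ B₀) (2 * B₀)| ^ m + |2 * B₀| ^ m) :=
              mul_le_mul_of_nonneg_left hMm (le_max_right _ _)
      gcongr
  · rintro ⟨hU, cₑ, hcₑ, hE⟩ ν T hν hT
    obtain ⟨F₁, hF₁⟩ := hE ν T hν hT
    choose G hG using fun E₀ B₀ => hU ν T hν hT E₀ B₀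
    obtain ⟨F₂, hF₂⟩ := levelSetModeration_latePairingBookkeeping ν T hν hT G
      (fun u p hcl hLH hdec E₀ B₀ hE hB => hG E₀ B₀ u p hcl hLH hdec hE hB) cₑ hcₑ
    refine ⟨0, by norm_num, fun E₀ B₀ => (Real.sqrt (F₁ E₀ B₀) + Real.sqrt (F₂ E₀ B₀)) ^ 2, ?_⟩
    intro u p hcl hLH hdec E₀ B₀ hE₀ hbd0 M c t hM hMc hcM hc ht
    rw [Real.rpow_zero, mul_one]
    set V : ℝ := (∫⁻ τ in Ioo 0 T, volume {x | c < ‖u τ x‖}).toReal with hV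
    set D : ℝ := (∫⁻ τ in Ioo 0 T, ∫⁻ x, {x | c < ‖u τ x‖}.indicator
      (fun x => ENNReal.ofReal (‖fderiv ℝ (fun y => ‖u τ y‖) x‖ ^ 2)) x).toReal with hD
    set P : ℝ → ℝ := fun τ => ∫ x, max (1 - c / ‖u τ x‖) 0 *
      (fderiv ℝ (normalisedPressure (u τ)) x (u τ x)) with hP
    have hV0 : 0 ≤ V := ENNReal.toReal_nonneg
    have hsq : Real.sqrt ((Real.sqrt (F₁ E₀ B₀) + Real.sqrt (F₂ E₀ B₀)) ^ 2 * V) =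
        (Real.sqrt (F₁ E₀ B₀) + Real.sqrt (F₂ E₀ B₀)) * Real.sqrt V := by
      rw [Real.sqrt_mul' _ hV0, Real.sqrt_sq (by positivity)]
    have h1 : Real.sqrt (F₁ E₀ B₀ * V) = Real.sqrt (F₁ E₀ B₀) * Real.sqrt V := Real.sqrt_mul' _ hV0
    have h2 : Real.sqrt (F₂ E₀ B₀ * V) = Real.sqrt (F₂ E₀ B₀) * Real.sqrt V := Real.sqrt_mul' _ hV0
    set s : ℝ := cₑ * ν / B₀ ^ 2 with hs
    have hs0 : 0 ≤ s := by rw [hs]; positivity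
    show -(∫ τ in Ioo 0 t, P τ) ≤
      Real.sqrt ((Real.sqrt (F₁ E₀ B₀) + Real.sqrt (F₂ E₀ B₀)) ^ 2 * V) * Real.sqrt D
    rw [hsq]
    have hD0 : 0 ≤ Real.sqrt D := Real.sqrt_nonneg _
    have hF₁0 : 0 ≤ Real.sqrt (F₁ E₀ B₀) * Real.sqrt V * Real.sqrt D := by positivity
    have hF₂0 : 0 ≤ Real.sqrt (F₂ E₀ B₀) * Real.sqrt V * Real.sqrt D := by positivity
    rcases le_or_gt t s with hts | hst
    · -- early: `t ≤ s`
      have hearly := hF₁ u p hcl hLH hdec E₀ B₀ hE₀ hbd0 M c t hM hMc hcM hc ht hts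
      rw [h1] at hearly
      calc -(∫ τ in Ioo 0 t, P τ) ≤ Real.sqrt (F₁ E₀ B₀) * Real.sqrt V * Real.sqrt D := hearly
        _ ≤ (Real.sqrt (F₁ E₀ B₀) + Real.sqrt (F₂ E₀ B₀)) * Real.sqrt V * Real.sqrt D := by
            nlinarith [hF₂0]
    · -- late: `s < t`; the late part over `(s, t)`
      have hlate := hF₂ u p hcl hLH hdec E₀ B₀ hE₀ hbd0 M c t hM hMc hcM hc ht hst.le
      rw [h2, ← hs] at hlate
      rcases eq_or_lt_of_le hs0 with hszero | hspos
      · -- `s = 0`: the late part is the whole pressure work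
        rw [← hszero] at hlate
        calc -(∫ τ in Ioo 0 t, P τ) ≤ Real.sqrt (F₂ E₀ B₀) * Real.sqrt V * Real.sqrt D := hlate
          _ ≤ (Real.sqrt (F₁ E₀ B₀) + Real.sqrt (F₂ E₀ B₀)) * Real.sqrt V * Real.sqrt D := by
              nlinarith [hF₁0]
      · -- `0 < s < t`: split at `s`
        have hsT : s ∈ Ico 0 T := ⟨hs0, hst.trans ht.2⟩
        have hearly := hF₁ u p hcl hLH hdec E₀ B₀ hE₀ hbd0 M c s hM hMc hcM hc hsT le_rfl
        rw [h1] at hearly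
        by_cases hint : IntegrableOn P (Ioo 0 t) volume
        · have hsplit : (∫ τ in Ioo 0 t, P τ) = (∫ τ in Ioo 0 s, P τ) + ∫ τ in Ioo s t, P τ := by
            rw [← Ioo_union_Ico_eq_Ioo hspos hst.le,
              setIntegral_union ((Iio_disjoint_Ici le_rfl).mono Ioo_subset_Iio_self Ico_subset_Ici_self)
                measurableSet_Ico
                (hint.mono_set (Ioo_subset_Ioo le_rfl hst.le))
                (hint.mono_set (Ico_subset_Ioo_left hspos |>.trans (Ioo_subset_Ioo le_rfl le_rfl))),
              integral_Ico_eq_integral_Ioo]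
          rw [hsplit, neg_add]
          calc -(∫ τ in Ioo 0 s, P τ) + -(∫ τ in Ioo s t, P τ)
              ≤ Real.sqrt (F₁ E₀ B₀) * Real.sqrt V * Real.sqrt D +
                Real.sqrt (F₂ E₀ B₀) * Real.sqrt V * Real.sqrt D := add_le_add hearly hlate
            _ = (Real.sqrt (F₁ E₀ B₀) + Real.sqrt (F₂ E₀ B₀)) * Real.sqrt V * Real.sqrt D := by ring
        · rw [integral_undef hint, neg_zero]
          positivity

end Summit.NavierStokesRegularity.NavierStokesRegularity.Theorems

end
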